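import Summits.QuantumAdvantage.QuantumAdvantage.Theorems.GaussRankPolyImpliesPPoly.Negative.ExponentialCoefficients

/-!
# Negative lemmas III-b: CAR algebra of Majorana combinations; the bilinear Majorana bound; the annihilator overlap bound

Disprover's support file for crux `SpinorFlattening.GaussRankPolyImpliesPPoly` (stmt-QuantumAdvantage-1247),
refuter-cdisprove-stmt-QuantumAdvantage-1247-g2-0 (gen 2, 2026-08-16); work file `Cruxes/GaussRankPolyImpliesPPoly/Disproof.lean`.
Part of the in-tree proof of the Gaussian fidelity bound `F_𝒢(M^{⊗t}) ≤ 2^{-t}` (CudbyStrelchuk2023 Lemma 3)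
from the annihilator definition `IsGaussian` (files MajoranaAction → MajoranaCAR → QuadraticRelations →
CornerLemma → GaussianFidelity). Sorry-free; nothing here asserts a Theses statement.

THIS FILE: adjointness of `*ᵥ` for the Hermitian form `star v ⬝ᵥ w`; `c(u)ᴴ = c(ū)`; the sesquilinear and
bilinear CAR (`majoranaComb_car`, `majoranaComb_anticomm`); `‖c(s)ψ‖² ≤ 2Σ|s_q|²‖ψ‖²`; the BILINEAR MAJORANA
BOUND `|Σ_q ⟨a, c_qφ⟩⟨b, c_qφ'⟩|² ≤ 4‖a‖²‖b‖²‖φ‖²‖φ'‖²`; the ANNIHILATOR OVERLAP BOUND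
(`L g = 0`, `LLᴴ + LᴴL = 2ν·1` ⇒ `2ν|⟨g,ψ⟩|² ≤ ‖g‖²(2ν‖ψ‖² − ‖Lψ‖²)`) and its corollary: a vector with
vanishing covariance matrix has Gaussian fidelity `≤ 1/2` (`gaussian_overlap_sq_le_half_of_cov`).
-/

set_option linter.dupNamespace false

noncomputable section

namespace Summit.QuantumAdvantage.QuantumAdvantage.Theorems.GaussRankPolyImpliesPPoly.Negative

open Literature.Computability.Cryptography Literature.Computability.QuantumComplexity
open Matrix

/-- Adjointness: `⟨v, Aᴴ w⟩ = ⟨A v, w⟩`. [folklore] -/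
theorem star_dotProduct_conjTranspose_mulVec {n : ℕ} (A : Matrix (QReg n) (QReg n) ℂ)
    (v w : QReg n → ℂ) : star v ⬝ᵥ (Aᴴ *ᵥ w) = star (A *ᵥ v) ⬝ᵥ w := by
  rw [dotProduct_mulVec, star_mulVec]

/-- Adjointness: `⟨v, A w⟩ = ⟨Aᴴ v, w⟩`. [folklore] -/
theorem star_dotProduct_mulVec {n : ℕ} (A : Matrix (QReg n) (QReg n) ℂ)
    (v w : QReg n → ℂ) : star v ⬝ᵥ (A *ᵥ w) = star (Aᴴ *ᵥ v) ⬝ᵥ w := by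
  rw [dotProduct_mulVec, star_mulVec, conjTranspose_conjTranspose]

/-- The adjoint of a Majorana combination `c(u) = Σ_p u_p c_p` is `c(ū)`. [folklore] -/
theorem conjTranspose_majoranaComb {n : ℕ} (u : Fin n × Bool → ℂ) :
    (∑ p : Fin n × Bool, u p • majorana n p.1 p.2)ᴴ =
      ∑ p : Fin n × Bool, star (u p) • majorana n p.1 p.2 := by
  rw [conjTranspose_sum]
  refine Finset.sum_congr rfl fun p _ => ?_
  rw [conjTranspose_smul, conjTranspose_majorana]

/-- **CAR for a Majorana combination**: `c(u) c(u)ᴴ + c(u)ᴴ c(u) = 2 (Σ_p |u_p|²) · 1`. [folklore] -/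
theorem majoranaComb_car {n : ℕ} (u : Fin n × Bool → ℂ) :
    (∑ p : Fin n × Bool, u p • majorana n p.1 p.2) * (∑ p : Fin n × Bool, u p • majorana n p.1 p.2)ᴴ +
      (∑ p : Fin n × Bool, u p • majorana n p.1 p.2)ᴴ * (∑ p : Fin n × Bool, u p • majorana n p.1 p.2) =
      ((2 * ∑ p : Fin n × Bool, ‖u p‖ ^ 2 : ℝ) : ℂ) • (1 : Matrix (QReg n) (QReg n) ℂ) := by
  rw [conjTranspose_majoranaComb, Finset.sum_mul_sum, Finset.sum_mul_sum, Finset.sum_comm (s := Finset.univ)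
    (t := Finset.univ) (f := fun p q => star (u p) • majorana n p.1 p.2 * (u q • majorana n q.1 q.2)),
    ← Finset.sum_add_distrib]
  have hterm : ∀ p : Fin n × Bool, (∑ q : Fin n × Bool, u p • majorana n p.1 p.2 * (star (u q) • majorana n q.1 q.2)) +
      (∑ q : Fin n × Bool, star (u q) • majorana n q.1 q.2 * (u p • majorana n p.1 p.2)) =
      ((‖u p‖ : ℂ) ^ 2) • ((2 : ℂ) • (1 : Matrix (QReg n) (QReg n) ℂ)) := by
    intro p
    rw [← Finset.sum_add_distrib]
    have : ∀ q : Fin n × Bool, u p • majorana n p.1 p.2 * (star (u q) • majorana n q.1 q.2) +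
        star (u q) • majorana n q.1 q.2 * (u p • majorana n p.1 p.2) =
        (u p * star (u q)) • (if p = q then (2 : ℂ) • (1 : Matrix (QReg n) (QReg n) ℂ) else 0) := by
      intro q
      rw [smul_mul_smul_comm, smul_mul_smul_comm, mul_comm (star (u q)) (u p), ← smul_add,
        majorana_anticommutator]
    simp_rw [this]
    rw [Finset.sum_eq_single p]
    · rw [if_pos rfl, Complex.star_def, Complex.mul_conj']
    · intro q _ hq
      rw [if_neg (Ne.symm hq), smul_zero]
    · intro h; exact absurd (Finset.mem_univ p) h
  simp_rw [hterm]
  rw [← Finset.sum_smul, smul_smul]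
  congr 1
  push_cast
  rw [Finset.sum_mul, Finset.mul_sum]
  refine Finset.sum_congr rfl fun p _ => ?_
  ring

/-- **Bilinear CAR** for Majorana combinations: `c(u) c(v) + c(v) c(u) = 2 (u ⬝ᵥ v) · 1`. [folklore] -/
theorem majoranaComb_anticomm {n : ℕ} (u v : Fin n × Bool → ℂ) :
    (∑ p : Fin n × Bool, u p • majorana n p.1 p.2) * (∑ p : Fin n × Bool, v p • majorana n p.1 p.2) +
      (∑ p : Fin n × Bool, v p • majorana n p.1 p.2) * (∑ p : Fin n × Bool, u p • majorana n p.1 p.2) =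
      (2 * (u ⬝ᵥ v)) • (1 : Matrix (QReg n) (QReg n) ℂ) := by
  rw [Finset.sum_mul_sum, Finset.sum_mul_sum, Finset.sum_comm (s := Finset.univ)
    (t := Finset.univ) (f := fun p q => v p • majorana n p.1 p.2 * (u q • majorana n q.1 q.2)),
    ← Finset.sum_add_distrib]
  have hterm : ∀ p : Fin n × Bool, (∑ q : Fin n × Bool, u p • majorana n p.1 p.2 * (v q • majorana n q.1 q.2)) +
      (∑ q : Fin n × Bool, v q • majorana n q.1 q.2 * (u p • majorana n p.1 p.2)) =
      (u p * v p) • ((2 : ℂ) • (1 : Matrix (QReg n) (QReg n) ℂ)) := by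
    intro p
    rw [← Finset.sum_add_distrib]
    have : ∀ q : Fin n × Bool, u p • majorana n p.1 p.2 * (v q • majorana n q.1 q.2) +
        v q • majorana n q.1 q.2 * (u p • majorana n p.1 p.2) =
        (u p * v q) • (if p = q then (2 : ℂ) • (1 : Matrix (QReg n) (QReg n) ℂ) else 0) := by
      intro q
      rw [smul_mul_smul_comm, smul_mul_smul_comm, mul_comm (v q) (u p), ← smul_add,
        majorana_anticommutator]
    simp_rw [this]
    rw [Finset.sum_eq_single p]
    · rw [if_pos rfl]
    · intro q _ hq
      rw [if_neg (Ne.symm hq), smul_zero]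
    · intro h; exact absurd (Finset.mem_univ p) h
  simp_rw [hterm]
  rw [← Finset.sum_smul, smul_smul]
  congr 1
  simp only [dotProduct, Finset.mul_sum, Finset.sum_mul]
  exact Finset.sum_congr rfl (fun p _ => by ring)

/-- Evaluation of a Majorana combination: `(c(w) G) v = w ⬝ᵥ (p ↦ (c_p G) v)`. [folklore] -/
theorem majoranaComb_mulVec_apply {n : ℕ} (w : Fin n × Bool → ℂ) (G : QReg n → ℂ) (v : QReg n) :
    ((∑ p : Fin n × Bool, w p • majorana n p.1 p.2) *ᵥ G) v =
      w ⬝ᵥ (fun p => (majorana n p.1 p.2 *ᵥ G) v) := by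
  rw [sum_mulVec, Finset.sum_apply, dotProduct]
  refine Finset.sum_congr rfl fun p _ => ?_
  rw [smul_mulVec, Pi.smul_apply, smul_eq_mul]

/-- `‖c(s) ψ‖² ≤ 2 (Σ_q |s_q|²) ‖ψ‖²` (from the CAR: `c(s)ᴴ c(s) = 2ν − c(s) c(s)ᴴ ≤ 2ν`). [folklore] -/
theorem normSq_majoranaComb_mulVec_le {n : ℕ} (s : Fin n × Bool → ℂ) (ψ : QReg n → ℂ) :
    normSq ((∑ q : Fin n × Bool, s q • majorana n q.1 q.2) *ᵥ ψ) ≤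
      2 * (∑ q : Fin n × Bool, ‖s q‖ ^ 2) * normSq ψ := by
  set L := ∑ q : Fin n × Bool, s q • majorana n q.1 q.2 with hL
  set c : ℂ := ((2 * ∑ q : Fin n × Bool, ‖s q‖ ^ 2 : ℝ) : ℂ) with hc
  have hCAR : L * Lᴴ + Lᴴ * L = c • (1 : Matrix (QReg n) (QReg n) ℂ) := by rw [hL, majoranaComb_car]
  have hLHL : Lᴴ * L = c • (1 : Matrix (QReg n) (QReg n) ℂ) - L * Lᴴ := eq_sub_of_add_eq' hCAR
  have h : star (L *ᵥ ψ) ⬝ᵥ (L *ᵥ ψ) = c * (star ψ ⬝ᵥ ψ) - star (Lᴴ *ᵥ ψ) ⬝ᵥ (Lᴴ *ᵥ ψ) := by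
    rw [← star_dotProduct_conjTranspose_mulVec L ψ (L *ᵥ ψ), mulVec_mulVec, hLHL, sub_mulVec,
      smul_mulVec, one_mulVec, ← mulVec_mulVec, dotProduct_sub, dotProduct_smul, smul_eq_mul,
      star_dotProduct_mulVec L ψ (Lᴴ *ᵥ ψ)]
  rw [star_dotProduct_self_eq_normSq, star_dotProduct_self_eq_normSq,
    star_dotProduct_self_eq_normSq, hc] at h
  have h' : normSq (L *ᵥ ψ) = (2 * ∑ q : Fin n × Bool, ‖s q‖ ^ 2) * normSq ψ - normSq (Lᴴ *ᵥ ψ) := by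
    exact_mod_cast h
  have hpos : 0 ≤ normSq (Lᴴ *ᵥ ψ) := Finset.sum_nonneg fun _ _ => by positivity
  linarith

/-- **BILINEAR MAJORANA BOUND**: `|Σ_q ⟨a, c_q φ⟩ ⟨bb, c_q φ'⟩|² ≤ 4 ‖a‖² ‖bb‖² ‖φ‖² ‖φ'‖²`
(write the sum as `⟨a, c(s) φ⟩` with `s_q = ⟨bb, c_q φ'⟩`, and bound `Σ|s_q|² ≤ 2‖bb‖²‖φ'‖²` the same
way). [folklore] -/
theorem majorana_bilinear_bound {n : ℕ} (a bb φ φ' : QReg n → ℂ) :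
    ‖∑ q : Fin n × Bool, (star a ⬝ᵥ (majorana n q.1 q.2 *ᵥ φ)) * (star bb ⬝ᵥ (majorana n q.1 q.2 *ᵥ φ'))‖ ^ 2
      ≤ 4 * normSq a * normSq bb * normSq φ * normSq φ' := by
  set s : Fin n × Bool → ℂ := fun q => star bb ⬝ᵥ (majorana n q.1 q.2 *ᵥ φ') with hs
  set ν : ℝ := ∑ q : Fin n × Bool, ‖s q‖ ^ 2 with hν
  -- the sum is `⟨a, c(s) φ⟩`
  have hsum : ∑ q : Fin n × Bool, (star a ⬝ᵥ (majorana n q.1 q.2 *ᵥ φ)) * s q =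
      star a ⬝ᵥ ((∑ q : Fin n × Bool, s q • majorana n q.1 q.2) *ᵥ φ) := by
    rw [sum_mulVec, dotProduct_sum]
    refine Finset.sum_congr rfl fun q _ => ?_
    rw [smul_mulVec, dotProduct_smul, smul_eq_mul, mul_comm]
  -- `ν ≤ 2 ‖bb‖² ‖φ'‖²`
  have hνC : ((ν : ℝ) : ℂ) = star bb ⬝ᵥ ((∑ q : Fin n × Bool, star (s q) • majorana n q.1 q.2) *ᵥ φ') := by
    rw [sum_mulVec, dotProduct_sum, hν]
    push_cast
    refine Finset.sum_congr rfl fun q _ => ?_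
    rw [smul_mulVec, dotProduct_smul, smul_eq_mul, ← Complex.conj_mul', Complex.star_def]
  have hν0 : 0 ≤ ν := Finset.sum_nonneg fun _ _ => by positivity
  have hbb0 : 0 ≤ normSq bb := Finset.sum_nonneg fun _ _ => by positivity
  have hφ'0 : 0 ≤ normSq φ' := Finset.sum_nonneg fun _ _ => by positivity
  have hνle : ν ≤ 2 * normSq bb * normSq φ' := by
    have h1 : ν ^ 2 ≤ normSq bb * (2 * ν * normSq φ') := by
      have hcs := norm_star_dotProduct_sq_le bb ((∑ q : Fin n × Bool, star (s q) • majorana n q.1 q.2) *ᵥ φ')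
      rw [← hνC, Complex.norm_real, Real.norm_eq_abs, abs_of_nonneg hν0] at hcs
      have hle := normSq_majoranaComb_mulVec_le (fun q => star (s q)) φ'
      have hstar : ∑ q : Fin n × Bool, ‖star (s q)‖ ^ 2 = ν := by
        rw [hν]; refine Finset.sum_congr rfl fun q _ => ?_; rw [norm_star]
      rw [hstar] at hle
      exact hcs.trans (mul_le_mul_of_nonneg_left hle hbb0)
    by_cases hz : ν = 0
    · rw [hz]; positivity
    · have hνpos : 0 < ν := lt_of_le_of_ne hν0 (Ne.symm hz)
      nlinarith
  -- Cauchy–Schwarz on `⟨a, c(s) φ⟩`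
  have ha0 : 0 ≤ normSq a := Finset.sum_nonneg fun _ _ => by positivity
  have hφ0 : 0 ≤ normSq φ := Finset.sum_nonneg fun _ _ => by positivity
  rw [hsum]
  calc ‖star a ⬝ᵥ ((∑ q : Fin n × Bool, s q • majorana n q.1 q.2) *ᵥ φ)‖ ^ 2
      ≤ normSq a * normSq ((∑ q : Fin n × Bool, s q • majorana n q.1 q.2) *ᵥ φ) :=
        norm_star_dotProduct_sq_le _ _
    _ ≤ normSq a * (2 * ν * normSq φ) :=
        mul_le_mul_of_nonneg_left (normSq_majoranaComb_mulVec_le s φ) ha0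
    _ ≤ normSq a * (2 * (2 * normSq bb * normSq φ') * normSq φ) := by gcongr
    _ = 4 * normSq a * normSq bb * normSq φ * normSq φ' := by ring

/-- **ANNIHILATOR OVERLAP BOUND** (operator form of the one-term mass bound). If `L g = 0` and
`L Lᴴ + Lᴴ L = 2ν · 1` with `ν > 0` (so `b = L/√(2ν)` is a canonical fermionic mode with `g` in its
kernel), then for every `ψ`:  `2ν |⟨g, ψ⟩|² ≤ ‖g‖² (2ν ‖ψ‖² − ‖L ψ‖²)`, i.e.
`|⟨g, ψ⟩|² ≤ ‖g‖² (‖ψ‖² − ‖b ψ‖²)`.  Proof: `2ν⟨g,ψ⟩ = ⟨g,(LLᴴ + LᴴL)ψ⟩ = ⟨Lᴴg, Lᴴψ⟩ + ⟨Lg, Lψ⟩ =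
⟨Lᴴg, Lᴴψ⟩`, Cauchy–Schwarz, `‖Lᴴg‖² = 2ν‖g‖² − ‖Lg‖² = 2ν‖g‖²`, `‖Lᴴψ‖² = 2ν‖ψ‖² − ‖Lψ‖²`. [folklore] -/
theorem overlap_bound_of_annihilator {n : ℕ} (L : Matrix (QReg n) (QReg n) ℂ) (g ψ : QReg n → ℂ)
    (ν : ℝ) (hν : 0 < ν)
    (hCAR : L * Lᴴ + Lᴴ * L = ((2 * ν : ℝ) : ℂ) • (1 : Matrix (QReg n) (QReg n) ℂ))
    (hLg : L *ᵥ g = 0) :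
    2 * ν * ‖star g ⬝ᵥ ψ‖ ^ 2 ≤ normSq g * (2 * ν * normSq ψ - normSq (L *ᵥ ψ)) := by
  set c : ℂ := ((2 * ν : ℝ) : ℂ) with hc
  have hLLH : L * Lᴴ = c • (1 : Matrix (QReg n) (QReg n) ℂ) - Lᴴ * L := eq_sub_of_add_eq hCAR
  -- (i) the key identity `c ⟨g,ψ⟩ = ⟨Lᴴ g, Lᴴ ψ⟩`
  have key : c * (star g ⬝ᵥ ψ) = star (Lᴴ *ᵥ g) ⬝ᵥ (Lᴴ *ᵥ ψ) := by
    have h1 : c • ψ = (L * Lᴴ + Lᴴ * L) *ᵥ ψ := by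
      rw [hCAR, smul_mulVec, one_mulVec]
    calc c * (star g ⬝ᵥ ψ) = star g ⬝ᵥ (c • ψ) := by rw [dotProduct_smul, smul_eq_mul]
      _ = star g ⬝ᵥ (L *ᵥ (Lᴴ *ᵥ ψ)) + star g ⬝ᵥ (Lᴴ *ᵥ (L *ᵥ ψ)) := by
          rw [h1, add_mulVec, dotProduct_add, ← mulVec_mulVec, ← mulVec_mulVec]
      _ = star (Lᴴ *ᵥ g) ⬝ᵥ (Lᴴ *ᵥ ψ) + star (L *ᵥ g) ⬝ᵥ (L *ᵥ ψ) := by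
          rw [star_dotProduct_mulVec L g (Lᴴ *ᵥ ψ), star_dotProduct_conjTranspose_mulVec L g (L *ᵥ ψ)]
      _ = star (Lᴴ *ᵥ g) ⬝ᵥ (Lᴴ *ᵥ ψ) := by rw [hLg, star_zero, zero_dotProduct, add_zero]
  -- (ii) `‖Lᴴ g‖² = 2ν ‖g‖²`
  have hA : normSq (Lᴴ *ᵥ g) = 2 * ν * normSq g := by
    have h : star (Lᴴ *ᵥ g) ⬝ᵥ (Lᴴ *ᵥ g) = c * (star g ⬝ᵥ g) := by
      rw [← star_dotProduct_mulVec L g (Lᴴ *ᵥ g), mulVec_mulVec, hLLH, sub_mulVec, smul_mulVec,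
        one_mulVec, ← mulVec_mulVec, hLg, mulVec_zero, sub_zero, dotProduct_smul, smul_eq_mul]
    rw [star_dotProduct_self_eq_normSq, star_dotProduct_self_eq_normSq, hc] at h
    exact_mod_cast h
  -- (iii) `‖Lᴴ ψ‖² = 2ν ‖ψ‖² − ‖L ψ‖²`
  have hB : normSq (Lᴴ *ᵥ ψ) = 2 * ν * normSq ψ - normSq (L *ᵥ ψ) := by
    have h : star (Lᴴ *ᵥ ψ) ⬝ᵥ (Lᴴ *ᵥ ψ) = c * (star ψ ⬝ᵥ ψ) - star (L *ᵥ ψ) ⬝ᵥ (L *ᵥ ψ) := by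
      rw [← star_dotProduct_mulVec L ψ (Lᴴ *ᵥ ψ), mulVec_mulVec, hLLH, sub_mulVec, smul_mulVec,
        one_mulVec, ← mulVec_mulVec, dotProduct_sub, dotProduct_smul, smul_eq_mul,
        star_dotProduct_conjTranspose_mulVec L ψ (L *ᵥ ψ)]
    rw [star_dotProduct_self_eq_normSq, star_dotProduct_self_eq_normSq,
      star_dotProduct_self_eq_normSq, hc] at h
    exact_mod_cast h
  -- (iv) Cauchy–Schwarz and bookkeeping
  have hcs := norm_star_dotProduct_sq_le (Lᴴ *ᵥ g) (Lᴴ *ᵥ ψ)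
  rw [← key, norm_mul, mul_pow, hA, hB, hc, Complex.norm_real, Real.norm_eq_abs,
    abs_of_pos (by positivity : (0 : ℝ) < 2 * ν)] at hcs
  -- hcs : (2ν)² X ≤ 2ν ‖g‖² (2ν‖ψ‖² − ‖Lψ‖²)
  have h2ν : (0 : ℝ) < 2 * ν := by positivity
  nlinarith [hcs, h2ν, sq_nonneg ‖star g ⬝ᵥ ψ‖]

/-- `‖c(u) ψ‖² = Σ_{p,q} ū_p u_q ⟨ψ, c_p c_q ψ⟩`; with VANISHING COVARIANCE (`⟨ψ, c_p c_q ψ⟩ = δ_pq ‖ψ‖²`)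
this is `(Σ_p |u_p|²) ‖ψ‖²`. [folklore] -/
theorem normSq_majoranaComb_mulVec_of_cov {n : ℕ} (u : Fin n × Bool → ℂ) (ψ : QReg n → ℂ)
    (hcov : ∀ p q : Fin n × Bool, star ψ ⬝ᵥ (majorana n p.1 p.2 *ᵥ (majorana n q.1 q.2 *ᵥ ψ)) =
      if p = q then ((normSq ψ : ℝ) : ℂ) else 0) :
    normSq ((∑ p : Fin n × Bool, u p • majorana n p.1 p.2) *ᵥ ψ) =
      (∑ p : Fin n × Bool, ‖u p‖ ^ 2) * normSq ψ := by
  set L := ∑ p : Fin n × Bool, u p • majorana n p.1 p.2 with hL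
  have hLψ : L *ᵥ ψ = ∑ q : Fin n × Bool, u q • (majorana n q.1 q.2 *ᵥ ψ) := by
    rw [hL, sum_mulVec]
    refine Finset.sum_congr rfl fun q _ => ?_
    rw [smul_mulVec]
  have hLH : Lᴴ = ∑ p : Fin n × Bool, star (u p) • majorana n p.1 p.2 := by
    rw [hL, conjTranspose_majoranaComb]
  have h : star (L *ᵥ ψ) ⬝ᵥ (L *ᵥ ψ) = (((∑ p : Fin n × Bool, ‖u p‖ ^ 2) * normSq ψ : ℝ) : ℂ) := by
    rw [← star_dotProduct_conjTranspose_mulVec L ψ (L *ᵥ ψ), hLH, sum_mulVec, dotProduct_sum]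
    have inner : ∀ p : Fin n × Bool,
        star ψ ⬝ᵥ ((star (u p) • majorana n p.1 p.2) *ᵥ (L *ᵥ ψ)) = star (u p) * u p * ((normSq ψ : ℝ) : ℂ) := by
      intro p
      rw [smul_mulVec, dotProduct_smul, smul_eq_mul, hLψ, mulVec_sum, dotProduct_sum]
      have : ∀ q : Fin n × Bool, star ψ ⬝ᵥ (majorana n p.1 p.2 *ᵥ (u q • (majorana n q.1 q.2 *ᵥ ψ))) =
          u q * (if p = q then ((normSq ψ : ℝ) : ℂ) else 0) := by
        intro q
        rw [mulVec_smul, dotProduct_smul, smul_eq_mul, hcov]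
      simp_rw [this]
      rw [Finset.sum_eq_single p]
      · rw [if_pos rfl, mul_assoc]
      · intro q _ hq
        rw [if_neg (Ne.symm hq), mul_zero]
      · intro h; exact absurd (Finset.mem_univ p) h
    simp_rw [inner]
    rw [← Finset.sum_mul]
    push_cast
    congr 1
    refine Finset.sum_congr rfl fun p _ => ?_
    rw [Complex.star_def, Complex.conj_mul']
  rw [star_dotProduct_self_eq_normSq] at h
  exact_mod_cast h

/-- **VANISHING COVARIANCE ⇒ GAUSSIAN FIDELITY ≤ 1/2.** If `ψ` on `n ≥ 1` qubits has vanishing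
covariance matrix in the strong form `⟨ψ, c_p c_q ψ⟩ = δ_pq ‖ψ‖²`, then every Gaussian `g` has
`|⟨g, ψ⟩|² ≤ ‖g‖² ‖ψ‖² / 2`. (Take `L = c(u)` for the first annihilator row `u` of `g`: `ν = Σ|u_p|² > 0`,
`‖Lψ‖² = ν‖ψ‖²` by the covariance hypothesis, and apply the annihilator overlap bound.) Applies to
`|M⟩^{⊗t}` (`t ≥ 1`, tight at `t = 1`) once the flat orthonormality of crux 1245 (`stub_flatOrthoOfInvariant`
+ the landed `stub_magicInvariant`) is a theorem; it is the `r = 1, K = 1` case of that line, in operator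
form. [folklore] -/
theorem gaussian_overlap_sq_le_half_of_cov {n : ℕ} (hn : 0 < n) (ψ : QReg n → ℂ)
    (hcov : ∀ p q : Fin n × Bool, star ψ ⬝ᵥ (majorana n p.1 p.2 *ᵥ (majorana n q.1 q.2 *ᵥ ψ)) =
      if p = q then ((normSq ψ : ℝ) : ℂ) else 0)
    (g : QReg n → ℂ) (hg : IsGaussian g) :
    ‖star g ⬝ᵥ ψ‖ ^ 2 ≤ normSq g * normSq ψ / 2 := by
  obtain ⟨-, A, hA, hann⟩ := hg
  set u : Fin n × Bool → ℂ := A ⟨0, hn⟩ with hu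
  have hu0 : u ≠ 0 := hA.ne_zero ⟨0, hn⟩
  set ν : ℝ := ∑ p : Fin n × Bool, ‖u p‖ ^ 2 with hν
  have hνpos : 0 < ν := by
    obtain ⟨p, hp⟩ : ∃ p, u p ≠ 0 := by
      by_contra hno
      push Not at hno
      exact hu0 (funext hno)
    exact lt_of_lt_of_le (by positivity : (0 : ℝ) < ‖u p‖ ^ 2)
      (Finset.single_le_sum (f := fun q => ‖u q‖ ^ 2) (fun _ _ => by positivity) (Finset.mem_univ p))
  set L := ∑ p : Fin n × Bool, u p • majorana n p.1 p.2 with hL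
  have hCAR : L * Lᴴ + Lᴴ * L = ((2 * ν : ℝ) : ℂ) • (1 : Matrix (QReg n) (QReg n) ℂ) := by
    rw [hL, majoranaComb_car]
  have hLg : L *ᵥ g = 0 := hann ⟨0, hn⟩
  have hb := overlap_bound_of_annihilator L g ψ ν hνpos hCAR hLg
  rw [hL, normSq_majoranaComb_mulVec_of_cov u ψ hcov] at hb
  have hg0 : 0 ≤ normSq g := Finset.sum_nonneg fun _ _ => by positivity
  have hψ0 : 0 ≤ normSq ψ := Finset.sum_nonneg fun _ _ => by positivity
  nlinarith [hb, hνpos, hg0, hψ0, mul_nonneg hg0 hψ0]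

end Summit.QuantumAdvantage.QuantumAdvantage.Theorems.GaussRankPolyImpliesPPoly.Negative
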